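import Mathlib
import Summits.KontsevichZagierPeriods.Zeta5Search.TypeSpacePoints
import HarnessLib

/-!
# ζ(5) search — the type-space law (zero regime), aggregation: `(W/(−p)^{m+3}, V/(−p)^m) ≡ −p·Σ_z k_z P_z (mod p²)` with `4Σ_z k_z = Res₀`

Cell `pub-zeta5` (HONEST FRAMING: systematic search; no irrationality claim unless certified), typer seat generation 11.
REPORT-gen2-g11 §4.1 for the tree statement `ResidueLaw.TypeSpaceLawZero`: in the regime "every pole class has `E ≥ −M` (`M ≥ 6` even),
pole classes of exponent `−M` non-self-conjugate with palindromic type list" there are `p`-integral `X, Y` and `p`-integral weights `k_z`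
supported on the live classes (`k_z = ĝ_zφ_z/4` on the deep classes, `ĝ_z/4` on the sub-deep classes) with
`‖W(b)/(−p)^{3−M} + pX‖ ≤ p⁻²`, `‖V(b)/(−p)^{−M} + pY‖ ≤ p⁻²`, `(X, Y) ≡ Σ_z k_z P_z (mod p)` (`P_z` the doubled orbit points `pointW/pointV`)
and `4Σ_z k_z = Σ_{deep} ĝφ + Σ_{sub-deep} ĝ` — the rational lift of the residue sum `Res₀` of `ResidueLaw.ResidueIdentityB` (`aggregate₃`).
Inputs: `deepW/V_norm`, `subW/V_norm`, `restW/V_norm`, `deep_data`, `gHat_pair_second`, `pointW_deep`, `sub_pair_point`, `sum_conj_symm`.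
Nothing here bears on irrationality.
-/

noncomputable section

open Finset

namespace Summit.KontsevichZagierPeriods.Zeta5Search.SecondOrder

open Summit.KontsevichZagierPeriods.Zeta5Search.DualSeries (InBox)
open Summit.KontsevichZagierPeriods.Zeta5Search.WedgeDictionary (coeffW coeffV)
open Summit.KontsevichZagierPeriods.Zeta5Search.CasoratianValuation (InPolytope)
open Summit.KontsevichZagierPeriods.Zeta5Search.ClusterValuation
open Summit.KontsevichZagierPeriods.Zeta5Search.PadicSeries
open Summit.KontsevichZagierPeriods.Zeta5Search.CellA (classW coeffW_eq_sum_classW padicNorm_p)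
open Summit.KontsevichZagierPeriods.Zeta5Search.ResidueLaw (pointW pointV liveClasses)

variable {p : ℕ} [hp : Fact p.Prime]

section Agg

variable (b : ℕ → ℤ) (hb : InPolytope b) (hp5 : 5 ≤ p) (hpn : (p : ℤ) ≤ b 0) (hwin : (b 0 + 2 : ℤ) < (p : ℤ) ^ 2)
  {M : ℕ} (hM : 6 ≤ M) (hMe : Even M)
  (G1 : ∀ x, x < p → 1 ≤ classPoleCount b p x → -(M : ℤ) ≤ classExp b p x)
  (G3 : ∀ x, x < p → 1 ≤ classPoleCount b p x → classExp b p x = -(M : ℤ) →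
    ¬ CentreIn b p x ∧ (classTypeList b p x).reverse = classTypeList b p x)
include hb hp5 hpn hwin hM hMe G1 G3

/-- **AGGREGATION for the type-space law (zero regime).**  `p`-integral `X, Y` and weights `k_z` on the live classes with
`W/(−p)^{3−M} ≡ −pX`, `V/(−p)^{−M} ≡ −pY (mod p²)`, `(X, Y) ≡ Σ_z k_z P_z (mod p)` and `4Σ_z k_z = Σ_{deep} ĝφ + Σ_{sub-deep} ĝ`. -/
theorem aggregate₃ : ∃ X Y : ℚ, ∃ k : ℕ → ℚ, padicNorm p X ≤ 1 ∧ padicNorm p Y ≤ 1 ∧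
    padicNorm p (coeffW b / (-(p : ℚ)) ^ (-(M : ℤ) + 3) + (p : ℚ) * X) ≤ (p : ℚ) ^ (-(2 : ℤ)) ∧
    padicNorm p (coeffV b / (-(p : ℚ)) ^ (-(M : ℤ)) + (p : ℚ) * Y) ≤ (p : ℚ) ^ (-(2 : ℤ)) ∧
    (∀ z, padicNorm p (k z) ≤ 1) ∧ (∀ z, k z ≠ 0 → z ∈ liveClasses b p M) ∧
    4 * ∑ z ∈ range p, k z =
      (∑ z ∈ (range p).filter (fun x => 1 ≤ classPoleCount b p x ∧ classExp b p x = -(M : ℤ)), gHat b p z * phiHat b p z)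
        + ∑ z ∈ (range p).filter (fun x => 1 ≤ classPoleCount b p x ∧ classExp b p x = -(M : ℤ) + 1), gHat b p z ∧
    padicNorm p (X - ∑ z ∈ range p, k z * pointW b p M z) ≤ (p : ℚ) ^ (-(1 : ℤ)) ∧
    padicNorm p (Y - ∑ z ∈ range p, k z * pointV b p M z) ≤ (p : ℚ) ^ (-(1 : ℤ)) := by
  have h0 : 0 ≤ b 0 := hb.1.1
  have hp0 : 0 < p := hp.out.pos
  have hp2 : p ≠ 2 := by omega
  have hpQ : (p : ℚ) ≠ 0 := Nat.cast_ne_zero.2 hp.out.ne_zero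
  obtain ⟨-, -, -, hn⟩ := thmA_data b hb hwin
  have hpn' : p ≤ (b 0).toNat := by omega
  have h2n : padicNorm p (2 : ℚ) = 1 := padicNorm_two hp2
  have h4n : padicNorm p (4 : ℚ) = 1 := by rw [show (4 : ℚ) = 2 * 2 by norm_num, padicNorm.mul, h2n, one_mul]
  have hhalf : padicNorm p ((1 : ℚ) / 2) = 1 := by rw [padicNorm.div, padicNorm.one, h2n, div_one]
  set m : ℤ := -(M : ℤ) with hm
  set D := (range p).filter (fun x => 1 ≤ classPoleCount b p x ∧ classExp b p x = m) with hD
  set S := (range p).filter (fun y => 1 ≤ classPoleCount b p y ∧ classExp b p y = m + 1) with hS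
  have hDsub : D ⊆ range p := filter_subset _ _
  have hSsub : S ⊆ range p := filter_subset _ _
  -- integrality of the ingredients
  have hg1 : ∀ x, x < p → padicNorm p (gHat b p x) ≤ 1 := fun x hx =>
    LevelClass.padicNorm_gHat_le_one b hb hp5 hx
      (mem_filter.2 ⟨mem_range.2 (by have := le_b0_of_lt b hpn hx; omega), rfl⟩)
  have hφ1 : ∀ x, padicNorm p (phiHat b p x) ≤ 1 := fun x => padicNorm_phiHat_le_one b hp2 x
  have hw1 : ∀ z, padicNorm p (wHat b p z) ≤ 1 := fun z => LevelClass.padicNorm_wHat_le_one b h0 hn hp2 z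
  have hv1 : ∀ z, padicNorm p (vHat b p z) ≤ 1 := fun z => LevelClass.padicNorm_vHat_le_one b h0 hn hp2
  have hw21 : ∀ z, padicNorm p (wHat2 b p z) ≤ 1 := fun z => padicNorm_wHat2_le_one b h0 hn hp2 z
  have hv21 : ∀ z, padicNorm p (vHat2 b p z) ≤ 1 := fun z => padicNorm_vHat2_le_one b h0 hn hp2 z
  -- ### deep classes
  have hDmem : ∀ x ∈ D, x < p ∧ 1 ≤ classPoleCount b p x ∧ classExp b p x = m := fun x hx => by
    obtain ⟨hxr, h⟩ := mem_filter.1 hx; exact ⟨mem_range.1 hxr, h⟩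
  have hdeep : ∀ x ∈ D, wHat b p x = 0 ∧ wHat2 b p x = pointW b p M x / 4 ∧
      vHat2 b p x - (topLevel b p x : ℚ) / 2 * vHat b p x = pointV b p M x / 4 ∧ vHat b p (conjClass b p x) = vHat b p x ∧
      ¬ CentreIn b p x := by
    intro x hx
    obtain ⟨hxp, h1, hE⟩ := hDmem x hx
    obtain ⟨hc, hpal⟩ := G3 x hxp h1 hE
    have hodd : Odd (3 + classExp b p x) := by
      rw [hE, hm]; obtain ⟨r, hr⟩ := hMe; exact ⟨1 - (r : ℤ), by omega⟩
    obtain ⟨hw0, -, -, hvc⟩ := deep_data b hb hpn hpal hxp hc rfl hodd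
    refine ⟨hw0, ?_, ?_, hvc, hc⟩
    · rw [pointW_deep b hb hpn hxp hc hpal hE]; unfold tauW; rw [hw0]; ring
    · rw [pointV_deep b hb hpn hxp hc hpal hE]; unfold tauV; ring
  -- ### the per-class models
  set MW : ℕ → ℚ := fun x =>
    (if x ∈ D then gHat b p x * (wHat b p x - (p : ℚ) * phiHat b p x * wHat2 b p x) else 0)
      + (if x ∈ S then -((p : ℚ) * gHat b p x * wHat b p x) else 0) with hMW
  set MV : ℕ → ℚ := fun x =>
    (if x ∈ D then gHat b p x * (vHat b p x - (p : ℚ) * phiHat b p x * vHat2 b p x) else 0)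
      + (if x ∈ S then -((p : ℚ) * gHat b p x * vHat b p x) else 0) with hMV
  have hclass : ∀ x ∈ range p,
      padicNorm p (classW b p x / (-(p : ℚ)) ^ (m + 3) - MW x) ≤ (p : ℚ) ^ (-(2 : ℤ)) ∧
      padicNorm p (classV b p x / (-(p : ℚ)) ^ m - MV x) ≤ (p : ℚ) ^ (-(2 : ℤ)) := by
    intro x hxr
    have hxp := mem_range.1 hxr
    by_cases hxD : x ∈ D
    · obtain ⟨-, h1, hE⟩ := hDmem x hxD
      have hxS : x ∉ S := fun h => by have := (mem_filter.1 h).2.2; omega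
      have e1 : MW x = gHat b p x * (wHat b p x - (p : ℚ) * phiHat b p x * wHat2 b p x) := by
        simp only [hMW, if_pos hxD, if_neg hxS, add_zero]
      have e2 : MV x = gHat b p x * (vHat b p x - (p : ℚ) * phiHat b p x * vHat2 b p x) := by
        simp only [hMV, if_pos hxD, if_neg hxS, add_zero]
      rw [e1, e2, ← hE]
      exact ⟨deepW_norm b hb hp5 hwin hxp h1, deepV_norm b hb hp5 hwin hxp h1 (by omega)⟩
    by_cases hxS : x ∈ S
    · obtain ⟨-, h1, hE⟩ := mem_filter.1 hxS
      have e1 : MW x = -((p : ℚ) * gHat b p x * wHat b p x) := by simp only [hMW, if_neg hxD, if_pos hxS, zero_add]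
      have e2 : MV x = -((p : ℚ) * gHat b p x * vHat b p x) := by simp only [hMV, if_neg hxD, if_pos hxS, zero_add]
      rw [e1, e2, sub_neg_eq_add, sub_neg_eq_add]
      exact ⟨subW_norm b hb hp5 hwin hxp h1 hE, subV_norm b hb hp5 hwin hxp h1 hE⟩
    · have e1 : MW x = 0 := by simp only [hMW, if_neg hxD, if_neg hxS, add_zero]
      have e2 : MV x = 0 := by simp only [hMV, if_neg hxD, if_neg hxS, add_zero]
      rw [e1, e2, sub_zero, sub_zero]
      have hrestE : 1 ≤ classPoleCount b p x → m + 2 ≤ classExp b p x := by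
        intro h1
        have hge := G1 x hxp h1
        have hne1 : classExp b p x ≠ m := fun h => hxD (mem_filter.2 ⟨hxr, h1, h⟩)
        have hne2 : classExp b p x ≠ m + 1 := fun h => hxS (mem_filter.2 ⟨hxr, h1, h⟩)
        omega
      exact ⟨restW_norm b hb hp5 hwin (by omega) fun h2 => hrestE (by omega),
        restV_norm b hb hp5 hwin hxp fun h1 => (hrestE h1).trans (CellA.classExp_le_classNu b p x)⟩
  -- ### the sums of the models
  set X := (∑ x ∈ D, gHat b p x * phiHat b p x * wHat2 b p x) + ∑ y ∈ S, gHat b p y * wHat b p y with hX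
  set Y := (∑ x ∈ D, gHat b p x * phiHat b p x * (vHat2 b p x - (topLevel b p x : ℚ) / 2 * vHat b p x))
    + ∑ y ∈ S, gHat b p y * vHat b p y with hY
  have hSW : ∑ x ∈ range p, MW x = -((p : ℚ) * X) := by
    have e : ∑ x ∈ range p, MW x = (∑ x ∈ D, gHat b p x * (wHat b p x - (p : ℚ) * phiHat b p x * wHat2 b p x))
        + ∑ y ∈ S, -((p : ℚ) * gHat b p y * wHat b p y) := by
      rw [hMW, sum_add_distrib, sum_ite_mem_subset hDsub, sum_ite_mem_subset hSsub]
    have hD0 : ∑ x ∈ D, gHat b p x * (wHat b p x - (p : ℚ) * phiHat b p x * wHat2 b p x) =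
        -((p : ℚ) * ∑ x ∈ D, gHat b p x * phiHat b p x * wHat2 b p x) := by
      rw [Finset.mul_sum, ← sum_neg_distrib]
      exact sum_congr rfl fun x hx => by rw [(hdeep x hx).1]; ring
    have hS0 : ∑ y ∈ S, -((p : ℚ) * gHat b p y * wHat b p y) = -((p : ℚ) * ∑ y ∈ S, gHat b p y * wHat b p y) := by
      rw [Finset.mul_sum, ← sum_neg_distrib]
      exact sum_congr rfl fun y _ => by ring
    rw [e, hX, hD0, hS0]; ring
  have hDconj : ∀ x ∈ D, conjClass b p x ∈ D := fun x hx =>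
    conj_mem_filter b h0 hp0 hpn' (P := fun c E => 1 ≤ c ∧ E = m) hx
  have hSconj : ∀ y ∈ S, conjClass b p y ∈ S := fun y hy =>
    conj_mem_filter b h0 hp0 hpn' (P := fun c E => 1 ≤ c ∧ E = m + 1) hy
  have hDv : padicNorm p ((∑ x ∈ D, gHat b p x * vHat b p x)
      - (p : ℚ) / 2 * ∑ x ∈ D, (topLevel b p x : ℚ) * phiHat b p x * gHat b p x * vHat b p x) ≤ (p : ℚ) ^ (-(2 : ℤ)) := by
    have h2s := sum_conj_symm b hpn' D (fun x hx => (hDmem x hx).1) hDconj (fun x => gHat b p x * vHat b p x)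
    have e : (∑ x ∈ D, gHat b p x * vHat b p x)
        - (p : ℚ) / 2 * ∑ x ∈ D, (topLevel b p x : ℚ) * phiHat b p x * gHat b p x * vHat b p x =
        (1 : ℚ) / 2 * ∑ x ∈ D, ((gHat b p x + gHat b p (conjClass b p x)
          - (topLevel b p x : ℚ) * p * phiHat b p x * gHat b p x) * vHat b p x) := by
      have : ∑ x ∈ D, (gHat b p x * vHat b p x + gHat b p (conjClass b p x) * vHat b p (conjClass b p x)) =
          ∑ x ∈ D, (gHat b p x + gHat b p (conjClass b p x)) * vHat b p x :=
        sum_congr rfl fun x hx => by rw [(hdeep x hx).2.2.2.1]; ring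
      have h3 : ∑ x ∈ D, gHat b p x * vHat b p x =
          (1 : ℚ) / 2 * ∑ x ∈ D, (gHat b p x + gHat b p (conjClass b p x)) * vHat b p x := by
        rw [← this, ← h2s]; ring
      have h4 : (1 : ℚ) / 2 * (∑ x ∈ D, (gHat b p x + gHat b p (conjClass b p x)) * vHat b p x)
          - (p : ℚ) / 2 * ∑ x ∈ D, (topLevel b p x : ℚ) * phiHat b p x * gHat b p x * vHat b p x =
          (1 : ℚ) / 2 * ∑ x ∈ D, ((gHat b p x + gHat b p (conjClass b p x)
            - (topLevel b p x : ℚ) * p * phiHat b p x * gHat b p x) * vHat b p x) := by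
        rw [Finset.mul_sum, Finset.mul_sum, Finset.mul_sum, ← sum_sub_distrib]
        exact sum_congr rfl fun x _ => by ring
      rw [h3, h4]
    rw [e, padicNorm.mul, hhalf, one_mul]
    refine padicNorm.sum_le' (fun x hx => ?_) (zpow_p_nonneg _)
    obtain ⟨hxp, -, hE⟩ := hDmem x hx
    have hxn := le_b0_of_lt b hpn hxp
    obtain ⟨hL, hL'⟩ := level_bounds' (p := p) b hxn
    have heven : Even (classExp b p x) := by rw [hE, hm]; obtain ⟨r, hr⟩ := hMe; exact ⟨-(r : ℤ), by omega⟩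
    have hpair := gHat_pair_second b hb hp5 hxp hL hL' (hdeep x hx).2.2.2.2 heven
    rw [padicNorm.mul]
    calc _ ≤ (p : ℚ) ^ (-(2 : ℤ)) * 1 := mul_le_mul hpair (hv1 _) (padicNorm.nonneg _) (zpow_p_nonneg _)
      _ = _ := mul_one _
  have hSV : padicNorm p (∑ x ∈ range p, MV x + (p : ℚ) * Y) ≤ (p : ℚ) ^ (-(2 : ℤ)) := by
    have e : ∑ x ∈ range p, MV x + (p : ℚ) * Y = (∑ x ∈ D, gHat b p x * vHat b p x)
        - (p : ℚ) / 2 * ∑ x ∈ D, (topLevel b p x : ℚ) * phiHat b p x * gHat b p x * vHat b p x := by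
      have eMV : ∑ x ∈ range p, MV x = (∑ x ∈ D, gHat b p x * (vHat b p x - (p : ℚ) * phiHat b p x * vHat2 b p x))
          + ∑ y ∈ S, -((p : ℚ) * gHat b p y * vHat b p y) := by
        rw [hMV, sum_add_distrib, sum_ite_mem_subset hDsub, sum_ite_mem_subset hSsub]
      have hD1 : (∑ x ∈ D, gHat b p x * (vHat b p x - (p : ℚ) * phiHat b p x * vHat2 b p x))
          + (p : ℚ) * ∑ x ∈ D, gHat b p x * phiHat b p x * (vHat2 b p x - (topLevel b p x : ℚ) / 2 * vHat b p x) =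
          (∑ x ∈ D, gHat b p x * vHat b p x)
            - (p : ℚ) / 2 * ∑ x ∈ D, (topLevel b p x : ℚ) * phiHat b p x * gHat b p x * vHat b p x := by
        rw [Finset.mul_sum, Finset.mul_sum, ← sum_add_distrib, ← sum_sub_distrib]
        exact sum_congr rfl fun x _ => by ring
      have hS1 : (∑ y ∈ S, -((p : ℚ) * gHat b p y * vHat b p y)) + (p : ℚ) * ∑ y ∈ S, gHat b p y * vHat b p y = 0 := by
        rw [Finset.mul_sum, ← sum_add_distrib]
        exact sum_eq_zero fun y _ => by ring
      rw [eMV, hY, mul_add]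
      linear_combination hD1 + hS1
    rw [e]; exact hDv
  -- ### the weights
  set k : ℕ → ℚ := fun z => (if z ∈ D then gHat b p z * phiHat b p z / 4 else 0)
    + (if z ∈ S then gHat b p z / 4 else 0) with hk
  have hkD : ∀ z ∈ D, k z = gHat b p z * phiHat b p z / 4 := fun z hz => by
    have hzS : z ∉ S := fun h => by have := (mem_filter.1 h).2.2; have := (hDmem z hz).2.2; omega
    simp only [hk, if_pos hz, if_neg hzS, add_zero]
  have hkS : ∀ z ∈ S, k z = gHat b p z / 4 := fun z hz => by
    have hzD : z ∉ D := fun h => by have := (mem_filter.1 hz).2.2; have := (hDmem z h).2.2; omega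
    simp only [hk, if_neg hzD, if_pos hz, zero_add]
  have hk0 : ∀ z, z ∉ D → z ∉ S → k z = 0 := fun z hzD hzS => by simp only [hk, if_neg hzD, if_neg hzS, add_zero]
  have hksum : ∀ f : ℕ → ℚ, ∑ z ∈ range p, k z * f z =
      (∑ z ∈ D, gHat b p z * phiHat b p z / 4 * f z) + ∑ z ∈ S, gHat b p z / 4 * f z := by
    intro f
    rw [← sum_ite_mem_subset hDsub, ← sum_ite_mem_subset hSsub, ← sum_add_distrib]
    refine sum_congr rfl fun z _ => ?_
    simp only [hk]; split_ifs <;> ring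
  -- `Σ_S ĝσ ≡ Σ_S (ĝ/4)·P (mod p)`, by symmetrisation over the conjugation
  have hSpair : padicNorm p ((∑ y ∈ S, gHat b p y * wHat b p y) - ∑ y ∈ S, gHat b p y / 4 * pointW b p M y)
        ≤ (p : ℚ) ^ (-(1 : ℤ)) ∧
      padicNorm p ((∑ y ∈ S, gHat b p y * vHat b p y) - ∑ y ∈ S, gHat b p y / 4 * pointV b p M y)
        ≤ (p : ℚ) ^ (-(1 : ℤ)) := by
    have hSp : ∀ y ∈ S, y < p := fun y hy => mem_range.1 (hSsub hy)
    have key : ∀ F G : ℕ → ℚ, (∀ y ∈ S, padicNorm p ((F y + F (conjClass b p y)) - (G y + G (conjClass b p y)))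
        ≤ (p : ℚ) ^ (-(1 : ℤ))) → padicNorm p ((∑ y ∈ S, F y) - ∑ y ∈ S, G y) ≤ (p : ℚ) ^ (-(1 : ℤ)) := by
      intro F G hFG
      have e : (∑ y ∈ S, F y) - ∑ y ∈ S, G y = (1 : ℚ) / 2 * ((2 * ∑ y ∈ S, F y) - 2 * ∑ y ∈ S, G y) := by ring
      rw [e, padicNorm.mul, hhalf, one_mul, sum_conj_symm b hpn' S hSp hSconj F, sum_conj_symm b hpn' S hSp hSconj G,
        ← sum_sub_distrib]
      exact padicNorm.sum_le' hFG (zpow_p_nonneg _)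
    constructor
    · refine key _ _ fun y hy => ?_
      obtain ⟨hyr, -, hE⟩ := mem_filter.1 hy
      exact (sub_pair_point b hb hp5 hpn hwin hMe (mem_range.1 hyr) hE).1
    · refine key _ _ fun y hy => ?_
      obtain ⟨hyr, -, hE⟩ := mem_filter.1 hy
      exact (sub_pair_point b hb hp5 hpn hwin hMe (mem_range.1 hyr) hE).2
  refine ⟨X, Y, k, ?_, ?_, ?_, ?_, ?_, ?_, ?_, ?_, ?_⟩
  · -- `X` is integral
    rw [hX]
    refine (padicNorm.nonarchimedean (p := p)).trans (max_le ?_ ?_)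
    · refine padicNorm.sum_le' (fun x hx => ?_) zero_le_one
      rw [padicNorm.mul, padicNorm.mul]
      calc _ ≤ (1 : ℚ) * 1 * 1 := mul_le_mul (mul_le_mul (hg1 x (hDmem x hx).1) (hφ1 x) (padicNorm.nonneg _) zero_le_one)
            (hw21 x) (padicNorm.nonneg _) (by norm_num)
        _ = 1 := by ring
    · refine padicNorm.sum_le' (fun y hy => ?_) zero_le_one
      rw [padicNorm.mul]
      calc _ ≤ (1 : ℚ) * 1 := mul_le_mul (hg1 y (mem_range.1 (hSsub hy))) (hw1 y) (padicNorm.nonneg _) zero_le_one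
        _ = 1 := one_mul _
  · -- `Y` is integral
    rw [hY]
    refine (padicNorm.nonarchimedean (p := p)).trans (max_le ?_ ?_)
    · refine padicNorm.sum_le' (fun x hx => ?_) zero_le_one
      have hin : padicNorm p (vHat2 b p x - (topLevel b p x : ℚ) / 2 * vHat b p x) ≤ 1 := by
        refine (padicNorm.sub (p := p)).trans (max_le (hv21 x) ?_)
        rw [padicNorm.mul, padicNorm.div, h2n, div_one]
        calc _ ≤ (1 : ℚ) * 1 := mul_le_mul (by simpa using padicNorm.of_nat (p := p) (topLevel b p x)) (hv1 x)
              (padicNorm.nonneg _) zero_le_one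
          _ = 1 := one_mul _
      rw [padicNorm.mul, padicNorm.mul]
      calc _ ≤ (1 : ℚ) * 1 * 1 := mul_le_mul (mul_le_mul (hg1 x (hDmem x hx).1) (hφ1 x) (padicNorm.nonneg _) zero_le_one)
            hin (padicNorm.nonneg _) (by norm_num)
        _ = 1 := by ring
    · refine padicNorm.sum_le' (fun y hy => ?_) zero_le_one
      rw [padicNorm.mul]
      calc _ ≤ (1 : ℚ) * 1 := mul_le_mul (hg1 y (mem_range.1 (hSsub hy))) (hv1 y) (padicNorm.nonneg _) zero_le_one
        _ = 1 := one_mul _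
  · have e : coeffW b / (-(p : ℚ)) ^ (-(M : ℤ) + 3) + (p : ℚ) * X =
        ∑ x ∈ range p, (classW b p x / (-(p : ℚ)) ^ (m + 3) - MW x) := by
      rw [sum_sub_distrib, hSW, coeffW_eq_sum_classW b hp0, sum_div]; ring
    rw [e]
    exact padicNorm.sum_le' (fun x hx => (hclass x hx).1) (zpow_p_nonneg _)
  · have e : coeffV b / (-(p : ℚ)) ^ (-(M : ℤ)) + (p : ℚ) * Y =
        (∑ x ∈ range p, (classV b p x / (-(p : ℚ)) ^ m - MV x)) + (∑ x ∈ range p, MV x + (p : ℚ) * Y) := by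
      rw [sum_sub_distrib, coeffV_eq_sum_classV b hp0, sum_div]; ring
    rw [e]
    exact (padicNorm.nonarchimedean (p := p)).trans
      (max_le (padicNorm.sum_le' (fun x hx => (hclass x hx).2) (zpow_p_nonneg _)) hSV)
  · -- `‖k_z‖ ≤ 1`
    intro z
    by_cases hzD : z ∈ D
    · rw [hkD z hzD, padicNorm.div, h4n, div_one, padicNorm.mul]
      calc _ ≤ (1 : ℚ) * 1 := mul_le_mul (hg1 z (hDmem z hzD).1) (hφ1 z) (padicNorm.nonneg _) zero_le_one
        _ = 1 := one_mul _
    by_cases hzS : z ∈ S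
    · rw [hkS z hzS, padicNorm.div, h4n, div_one]; exact hg1 z (mem_range.1 (hSsub hzS))
    · rw [hk0 z hzD hzS, padicNorm.zero]; exact zero_le_one
  · -- support of `k`
    intro z hz
    by_cases hzD : z ∈ D
    · obtain ⟨hzp, h1, hE⟩ := hDmem z hzD
      exact mem_filter.2 ⟨mem_range.2 hzp, h1, Or.inl hE⟩
    by_cases hzS : z ∈ S
    · obtain ⟨hzr, h1, hE⟩ := mem_filter.1 hzS
      exact mem_filter.2 ⟨hzr, h1, Or.inr hE⟩
    · exact absurd (hk0 z hzD hzS) hz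
  · -- `4Σk = Σ_D ĝφ + Σ_S ĝ`
    have := hksum fun _ => 1
    simp only [mul_one] at this
    rw [this, mul_add, Finset.mul_sum, Finset.mul_sum]
    congr 1
    · exact sum_congr rfl fun z _ => by ring
    · exact sum_congr rfl fun z _ => by ring
  · -- `X − Σ k·P_W = Σ_S ĝŵ − Σ_S (ĝ/4)P_W`
    have e : X - ∑ z ∈ range p, k z * pointW b p M z =
        (∑ y ∈ S, gHat b p y * wHat b p y) - ∑ y ∈ S, gHat b p y / 4 * pointW b p M y := by
      have hDsum : ∑ z ∈ D, gHat b p z * phiHat b p z / 4 * pointW b p M z = ∑ x ∈ D, gHat b p x * phiHat b p x * wHat2 b p x :=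
        sum_congr rfl fun x hx => by rw [(hdeep x hx).2.1]; ring
      rw [hksum, hDsum, hX]; ring
    rw [e]; exact hSpair.1
  · have e : Y - ∑ z ∈ range p, k z * pointV b p M z =
        (∑ y ∈ S, gHat b p y * vHat b p y) - ∑ y ∈ S, gHat b p y / 4 * pointV b p M y := by
      have hDsum : ∑ z ∈ D, gHat b p z * phiHat b p z / 4 * pointV b p M z =
          ∑ x ∈ D, gHat b p x * phiHat b p x * (vHat2 b p x - (topLevel b p x : ℚ) / 2 * vHat b p x) :=
        sum_congr rfl fun x hx => by
          have h := (hdeep x hx).2.2.1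
          rw [show pointV b p M x = 4 * (vHat2 b p x - (topLevel b p x : ℚ) / 2 * vHat b p x) by rw [h]; ring]; ring
      rw [hksum, hDsum, hY]; ring
    rw [e]; exact hSpair.2

end Agg

end Summit.KontsevichZagierPeriods.Zeta5Search.SecondOrder

end
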